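import Mathlib.AlgebraicGeometry.Morphisms.Proper
import Mathlib.AlgebraicGeometry.Morphisms.FiniteType
import Mathlib.AlgebraicGeometry.Morphisms.QuasiCompact
import Mathlib.AlgebraicGeometry.Properties
import Mathlib.AlgebraicGeometry.Restrict
import Mathlib.RingTheory.RegularLocalRing.Defs
import Mathlib.Topology.KrullDimension
import Mathlib.Algebra.CharP.Defs
import HarnessLib

/-!
# Resolution of singularities (positive characteristic — open)

Topic: `Literature/AlgebraicGeometry/Resolution`. Definition request
`defn-ResolutionOfSingularities`: the statement of the tier-2 summit `ResolutionOfSingularities`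
(D-0013; `Summits/ResolutionOfSingularities/Statement.lean` imports this file).

## Content (glue on Mathlib's scheme library)

* `Scheme.IsRegular X` — every local ring `𝒪_{X,x}` is a regular local ring (Mathlib
  `IsRegularLocalRing`) (EGA IV₁ 0.17.3.6 / Stacks 02IS: "regular scheme").
* `IsBirational π` for `π : X' ⟶ X` — there is a dense open `U ⊆ X` with dense preimage over
  which `π` restricts to an isomorphism (Stacks, Tag 01RN: for schemes with finitely many
  irreducible components this is equivalent to "bijection on generic points + isomorphisms of the
  local rings at them"; both `X` and `X'` here will have finitely many components).
* `IsResolution π` — `π` is proper, birational, with regular source (Kollár 2007, Def./Thm. 3.36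
  wording; Hironaka 1964).
* `Scheme.HasResolution X`.
* `ResolutionInChar p` — **resolution of singularities in characteristic `p`**: every reduced,
  separated scheme of finite type over every field of characteristic `p` has a resolution.
* `ResolutionOfSingularities : Prop := ∀ p prime, ResolutionInChar p` — the summit conjunct
  (open in every positive characteristic in dimension `≥ 4`).
* Named facts (published theorems, `def … : Prop`): `Hironaka1964` (`ResolutionInChar 0`, in
  the form Kollár 2007, Thm. 3.36) and `CossartPiltant2019` (dimension `≤ 3`, all
  characteristics).

## Sources

* H. Hironaka, *Resolution of singularities of an algebraic variety over a field of
  characteristic zero I–II*, Ann. of Math. 79 (1964), Main Theorem I.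
* J. Kollár, *Lectures on Resolution of Singularities*, Ann. of Math. Stud. 166, PUP 2007,
  Thm. 3.36 (strong resolution for reduced separated schemes of finite type in char. 0).
* V. Cossart, O. Piltant, *Resolution of singularities of arithmetical threefolds*, J. Algebra 529
  (2019), 268–535, Thm. 1.1 (reduced separated quasi-excellent Noetherian schemes of dimension
  `≤ 3`).
* The Stacks Project, Tag 01RN (birational morphisms), Tag 02IS (regular schemes).
* A. Grothendieck, EGA IV₂ 7.9.6 (the excellent-scheme form of the problem).

## Design choices and wording risks (registry ruling: reduced separated finite type over a field)

* **Which schemes.** The registry rules "reduced separated finite type over a field of char `p`":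
  reduced (so several components are allowed, non-reduced structure is not), separated, of finite
  type = locally of finite type + quasi-compact (Mathlib classes on the structure morphism
  `X ⟶ Spec k`). Grothendieck's excellent-scheme form (EGA IV₂ 7.9.6) is wider and not stated.
* **Regular vs smooth.** Over a perfect field regular = smooth; over an imperfect field the
  resolution is asked to be *regular* (the registry wording "all stalks regular local rings"),
  which is the standard form of the conjecture (smoothness over `k` can fail for regular `X̃`).
* **Birational** as "isomorphism over a dense open with dense preimage" — the elementary form,
  adequate because reduced schemes of finite type over a field and their proper modifications have
  finitely many irreducible components (Stacks 01RN).
* No requirement that `π` be an isomorphism over the regular locus, nor projectivity of `π`, nor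
  simple-normal-crossings exceptional divisor ("strong"/"embedded" resolution): the conjunct is the
  weak existence statement, exactly as in the registry text. Kollár's char-0 theorem is vendored in
  the same weak form (it proves more).
* **Universe.** `ResolutionInChar.{u} p` quantifies over fields and schemes in universe `u`; the
  summit conjunct fixes `u = 0` (a `Prop` without universe parameters, as `Statement.lean` needs).
-/

noncomputable section

open CategoryTheory AlgebraicGeometry TopologicalSpace

namespace Literature.AlgebraicGeometry.Resolution

universe u

/-! ## Regular schemes, birational morphisms, resolutions -/

/-- A scheme is **regular** if all its local rings `𝒪_{X,x}` are regular local rings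
(Noetherian local rings whose maximal ideal is generated by `dim` elements; Mathlib
`IsRegularLocalRing`) (Stacks, Tag 02IS; EGA IV₁ 0.17.3.6). [cite: StacksProject, Tag 02IS] -/
def Scheme.IsRegular (X : Scheme.{u}) : Prop :=
  ∀ x : X, IsRegularLocalRing (X.presheaf.stalk x)

/-- A morphism `π : X' ⟶ X` is **birational** if there is a dense open `U ⊆ X` whose preimage is
dense in `X'` and over which `π` restricts to an isomorphism `π⁻¹(U) ≅ U` (Stacks, Tag 01RN — the
form appropriate for schemes with finitely many irreducible components, e.g. reduced schemes of
finite type over a field). [cite: StacksProject, Tag 01RN] -/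
def IsBirational {X' X : Scheme.{u}} (π : X' ⟶ X) : Prop :=
  ∃ U : X.Opens, Dense (U : Set X) ∧ Dense ((π ⁻¹ᵁ U : X'.Opens) : Set X') ∧ IsIso (π ∣_ U)

/-- `π : X' ⟶ X` is a **resolution of singularities** of `X`: `π` is proper and birational and
`X'` is regular (Hironaka 1964, Introduction; Kollár 2007, Thm. 3.36, weak form: no condition over
the regular locus and no normal-crossings requirement). [cite: Kollar2007, Thm. 3.36] -/
structure IsResolution {X' X : Scheme.{u}} (π : X' ⟶ X) : Prop where
  /-- `π` is proper -/
  isProper : IsProper π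
  /-- `π` is birational -/
  isBirational : IsBirational π
  /-- the source is regular -/
  isRegular : Scheme.IsRegular X'

/-- `X` **admits a resolution of singularities**: some proper birational `π : X' ⟶ X` from a
regular scheme (Hironaka 1964; Kollár 2007, Ch. 3). [cite: Kollar2007, Thm. 3.36] -/
def Scheme.HasResolution (X : Scheme.{u}) : Prop :=
  ∃ (X' : Scheme.{u}) (π : X' ⟶ X), IsResolution π

/-! ## The statements -/

/-- **Resolution of singularities in characteristic `p`** (for `p = 0` Hironaka's theorem, for a
prime `p` open in dimension `≥ 4`): for every field `k` of characteristic `p` and every reduced,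
separated `k`-scheme of finite type `X → Spec k`, there is a proper birational morphism
`π : X̃ → X` with `X̃` regular (Hironaka 1964, Main Theorem I for `p = 0`; the positive
characteristic problem: Kollár 2007, Ch. 3 introduction; EGA IV₂ 7.9.6).
[cite: Kollar2007, Thm. 3.36 (char 0) and Ch. 3 (the problem in char p)] -/
def ResolutionInChar (p : ℕ) : Prop :=
  ∀ (k : Type u) [Field k] [CharP k p] (X : Scheme.{u}) (f : X ⟶ Spec (.of k)),
    IsSeparated f → LocallyOfFiniteType f → QuasiCompact f → IsReduced X →
      Scheme.HasResolution X

/-- **Resolution of singularities in positive characteristic** (summit `ResolutionOfSingularities`,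
D-0013): for every prime `p`, every field `k` of characteristic `p` and every reduced separated
`k`-scheme `X` of finite type, there is a proper birational `π : X̃ → X` with `X̃` regular. Open
(known for `dim X ≤ 3`, `CossartPiltant2019`). Fields and schemes are taken in universe `0`.
[cite: Kollar2007, Ch. 3 (resolution in positive characteristic, open)] -/
def ResolutionOfSingularities : Prop :=
  ∀ p : ℕ, p.Prime → ResolutionInChar.{0} p

/-! ## Named facts -/

/-- NAMED FACT — **Hironaka's theorem** (Hironaka 1964, Main Theorem I; in the form of
Kollár 2007, Thm. 3.36: every reduced separated scheme of finite type over a field of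
characteristic zero admits a (strong, projective) resolution — vendored in the weak form used
here). Users take `(h : Hironaka1964)`. [cite: Hironaka1964, Main Theorem I] -/
def Hironaka1964 : Prop :=
  ResolutionInChar.{u} 0

/-- NAMED FACT — **Cossart–Piltant** (2019, Thm. 1.1: reduced, separated, quasi-excellent
Noetherian schemes of dimension at most three admit a resolution of singularities by a proper
birational morphism; specialised to schemes of finite type over a field, which are excellent).
For every field `k` (any characteristic) and every reduced separated `k`-scheme of finite type of
(topological Krull) dimension `≤ 3`, a resolution exists. Users take `(h : CossartPiltant2019)`.
[cite: CossartPiltant2019, Thm. 1.1] -/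
def CossartPiltant2019 : Prop :=
  ∀ (k : Type u) [Field k] (X : Scheme.{u}) (f : X ⟶ Spec (.of k)),
    IsSeparated f → LocallyOfFiniteType f → QuasiCompact f → IsReduced X →
      topologicalKrullDim X ≤ 3 → Scheme.HasResolution X

/-! ## API -/

/-- A regular scheme is its own resolution (the identity is proper and birational over `U = X`).
[folklore] -/
theorem Scheme.IsRegular.hasResolution {X : Scheme.{u}} (h : Scheme.IsRegular X) :
    Scheme.HasResolution X := by
  refine ⟨X, 𝟙 X, inferInstance, ⟨⊤, ?_, ?_, ?_⟩, h⟩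
  · simp
  · simp
  · infer_instance

/-- Resolution in characteristic `p` at universe `u` gives it for the prime field data used by
the summit when `u = 0`; conversely the summit conjunct is the conjunction over primes.
[folklore] -/
theorem resolutionOfSingularities_iff :
    ResolutionOfSingularities ↔ ∀ p : ℕ, p.Prime → ResolutionInChar.{0} p :=
  Iff.rfl

/-- Cossart–Piltant settles the summit statement for schemes of dimension `≤ 3`: under
`CossartPiltant2019`, every reduced separated finite-type scheme of dimension `≤ 3` over a field of
characteristic `p` has a resolution. [cite: CossartPiltant2019, Thm. 1.1] -/
theorem hasResolution_of_dim_le_three (h : CossartPiltant2019.{u}) {p : ℕ} (k : Type u) [Field k]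
    [CharP k p] (X : Scheme.{u}) (f : X ⟶ Spec (.of k)) [IsSeparated f] [LocallyOfFiniteType f]
    [QuasiCompact f] [IsReduced X] (hdim : topologicalKrullDim X ≤ 3) :
    Scheme.HasResolution X :=
  h k X f ‹_› ‹_› ‹_› ‹_› hdim

end Literature.AlgebraicGeometry.Resolution

end
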